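import Literature.NumberTheory.ConnesMoscovici2022.UVProlateMaxDomainFourier
import Literature.NumberTheory.ConnesMoscovici2022.UVProlateCutoffCommutation
import Literature.NumberTheory.ConnesMoscovici2022.UVProlateDeficiencyODE
import Literature.Analysis.Fourier.SincSmooth
import Literature.Analysis.FunctionSpaces.PlancherelL1L2
import Mathlib.Analysis.Calculus.BumpFunction.FiniteDimension
import HarnessLib

/-!
# Connes–Moscovici 2022, §1: the four boundary test vectors `β_±, β̂_±` lie in `𝓛_β = dom W_sa`

LINE 1 — FRAMING. RH-FREE corpus literature (cell rh-crit, C1 Connes–Consani/Moscovici corpus,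
row O2 `UVProlateSpectrum`; sequel material, no leaf / binder role in any route).
bears_on: LADDER-RH W-C/W-P.  WHAT THIS IS NOT: any claim about `ζ` or RH; nothing in this file
bears on the truth of RH.  No named facts, no `sorry`; the `def`s are explicit functions / vectors.

Source: A. Connes, H. Moscovici, *The UV prolate spectrum matches the zeros of zeta*, PNAS 119
(2022) [bib `ConnesMoscovici2022`] = arXiv:2112.05500 §2 (held text `paper-arxiv-2112.05500`):
the vectors `β_+ = 1_I`, `β_- = x·1_I` (chunk p0005:L84–L88: "we take `β_+(x) = 1_I`, the
characteristic function of the interval `I = [−λ, λ]`, which belongs to `P_λ 𝒮(ℝ)` and hence to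
`dom W_max`. Next for `ℰ_-` we let … `β_-(x) := x β_+(x)`"), their Fourier transforms (Lemma 1.4 (ii),
p0005:L75: "`𝔽_{e_ℝ} 1_I(y) = sin(2πλy)/(πy)`", and p0005:L96: "`β̂_-(x) = (i/2π) ∂_x β̂_+(x)`"), and
the step of the proof of Theorem 1.6 (= arXiv Thm 2.6, p0006:L83–L85): "every element of `𝓛_β` is
a linear combination of an element `ξ ∈ dom W_min` and the 4 vectors `β_±, β̂_±`" — in particular
THE FOUR VECTORS BELONG TO `𝓛_β`, which is what this file proves against the tree's explicit
boundary-condition definition of `𝓛_β = prolateSASet` ((1.19)–(1.21)).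

## Contents (all PROVED)

* §1 `testBump` (a Schwartz function `≡ 1` near `I`), `betaPlus = P_λ(testBump) = 1_I`,
  `betaMinus = P_λ(x·testBump) = x·1_I` as vectors of `L²(ℝ)`; a.e. formulas; membership in
  `dom W_max` with `W_max β_± = 0` a.e. OUTSIDE `I` (tree `cutoffProj_mem_prolateMax`, t8 g2).
* §2 the explicit Fourier transforms: `phiPlus y = sin(2πλy)/(πy)` (`= 2λ sinc(2πλy)`, smooth on
  all of `ℝ`, tree `contDiff_sinc`), `phiMinus = (i/2π) phiPlus′`; `𝓕 β_+ = phiPlus`,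
  `𝓕 β_- = phiMinus` a.e. (tree `CM22_lemma_1_4_ii`, `fourier_toLp_ae_eq_fourierIntegral`, and the
  elementary integral `∫_{−λ}^{λ} x e^{−2πixy} dx`); parity `𝓕⁻¹β_+ = 𝓕β_+`, `𝓕⁻¹β_- = −𝓕β_-`.
* §3 **`betaPlus_mem_prolateSASet`, `betaMinus_mem_prolateSASet`, `fourier_betaPlus_mem_prolateSASet`,
  `fourier_betaMinus_mem_prolateSASet`**: the four vectors satisfy (1.19)–(1.21) — for `β̂_+` the
  boundary expression (1.20) VANISHES IDENTICALLY (`bcInfEven_phiPlus`), for `β̂_-` (1.21) is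
  `(i/2π²)(−2πλ/x + sin cos/x²) → 0`.

Consumer: `UVProlateFourierInvariance.lean` (this seat; Thm 1.6 (i) 𝓕-clause).
-/

noncomputable section

open Complex Set MeasureTheory Filter Topology SchwartzMap FourierTransform
open scoped Real Topology ENNReal InnerProductSpace

namespace Literature.NumberTheory.ConnesMoscovici2022

open Literature.NumberTheory.ConnesConsani2021 Literature.Analysis.OperatorTheory

variable {lam : ℝ}

/-! ## §1. The bump `≡ 1` near `I`, and `β_± ∈ dom W_max` -/

/-- The open set `{x ≠ ±λ}` is open. [folklore] -/
private theorem isOpen_U (lam : ℝ) : IsOpen {x : ℝ | x ≠ lam ∧ x ≠ -lam} := isOpen_ne.and isOpen_ne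

/-- A real bump (Mathlib `ContDiffBump` at `0`, radii `2λ < 3λ`): `≡ 1` on `[−2λ, 2λ] ⊇ I`.
[cite: ConnesMoscovici2022, Lemma 1.5 setup "`β_+ … belongs to P_λ 𝒮(ℝ)`" (= arXiv:2112.05500 chunk p0005:L86)] -/
def testBumpR (lam : ℝ) (hlam : 0 < lam) : ContDiffBump (0 : ℝ) :=
  ⟨2 * lam, 3 * lam, by positivity, by linarith⟩

/-- The bump as a complex-valued smooth compactly supported function. [cite: ConnesMoscovici2022, Lemma 1.5 setup (= arXiv:2112.05500 chunk p0005:L86)] -/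
def testBumpFun (lam : ℝ) (hlam : 0 < lam) (x : ℝ) : ℂ := ((testBumpR lam hlam x : ℝ) : ℂ)

/-- The bump is smooth. [cite: ConnesMoscovici2022, Lemma 1.5 setup (= arXiv:2112.05500 chunk p0005:L86)] -/
theorem contDiff_testBumpFun (hlam : 0 < lam) : ContDiff ℝ (⊤ : ℕ∞) (testBumpFun lam hlam) :=
  ofRealCLM.contDiff.comp (testBumpR lam hlam).contDiff

/-- The bump has compact support. [cite: ConnesMoscovici2022, Lemma 1.5 setup (= arXiv:2112.05500 chunk p0005:L86)] -/
theorem hasCompactSupport_testBumpFun (hlam : 0 < lam) : HasCompactSupport (testBumpFun lam hlam) :=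
  (testBumpR lam hlam).hasCompactSupport.comp_left ofReal_zero

/-- `testBumpFun = 1` on `[−2λ, 2λ]`. [cite: ConnesMoscovici2022, Lemma 1.5 setup (= arXiv:2112.05500 chunk p0005:L86)] -/
theorem testBumpFun_eq_one (hlam : 0 < lam) {x : ℝ} (hx : |x| ≤ 2 * lam) :
    testBumpFun lam hlam x = 1 := by
  have h : testBumpR lam hlam x = 1 :=
    (testBumpR lam hlam).one_of_mem_closedBall (by simpa [testBumpR, Real.dist_eq] using hx)
  simp [testBumpFun, h]

/-- The Schwartz function `f_+ := testBumpFun`. [cite: ConnesMoscovici2022, Lemma 1.5 setup (= arXiv:2112.05500 chunk p0005:L86)] -/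
def testBump (lam : ℝ) (hlam : 0 < lam) : 𝓢(ℝ, ℂ) :=
  (hasCompactSupport_testBumpFun hlam).toSchwartzMap (contDiff_testBumpFun hlam)

/-- Unfolding. [cite: ConnesMoscovici2022, Lemma 1.5 setup (= arXiv:2112.05500 chunk p0005:L86)] -/
@[simp] theorem testBump_apply (hlam : 0 < lam) (x : ℝ) :
    testBump lam hlam x = testBumpFun lam hlam x := rfl

/-- The Schwartz function `f_- := x · testBumpFun`. [cite: ConnesMoscovici2022, Lemma 1.5 setup "`β_-(x) := x β_+(x)`" (= arXiv:2112.05500 chunk p0005:L88)] -/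
def testBumpX (lam : ℝ) (hlam : 0 < lam) : 𝓢(ℝ, ℂ) :=
  ((hasCompactSupport_testBumpFun hlam).mul_left (f := fun x : ℝ ↦ (x : ℂ))).toSchwartzMap
    ((ofRealCLM.contDiff).mul (contDiff_testBumpFun hlam))

/-- Unfolding. [cite: ConnesMoscovici2022, Lemma 1.5 setup (= arXiv:2112.05500 chunk p0005:L88)] -/
@[simp] theorem testBumpX_apply (hlam : 0 < lam) (x : ℝ) :
    testBumpX lam hlam x = (x : ℂ) * testBumpFun lam hlam x := rfl

/-- **`β_+ := P_λ f_+`** — the vector `1_I ∈ L²(ℝ)` ("`β_+(x) = 1_I` … belongs to `P_λ 𝒮(ℝ)`").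
[cite: ConnesMoscovici2022, Lemma 1.5 setup (= arXiv:2112.05500 chunk p0005:L86)] -/
def betaPlus (lam : ℝ) (hlam : 0 < lam) : L2R := cutoffProj lam (schwartzToL2 (testBump lam hlam))

/-- **`β_- := P_λ f_-`** — the vector `x·1_I ∈ L²(ℝ)`. [cite: ConnesMoscovici2022, Lemma 1.5 setup (= arXiv:2112.05500 chunk p0005:L88)] -/
def betaMinus (lam : ℝ) (hlam : 0 < lam) : L2R := cutoffProj lam (schwartzToL2 (testBumpX lam hlam))

/-- `β_+ = 1_{[−λ,λ]}` a.e. [cite: ConnesMoscovici2022, Lemma 1.5 setup (= arXiv:2112.05500 chunk p0005:L86)] -/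
theorem betaPlus_coeFn (hlam : 0 < lam) :
    ((betaPlus lam hlam : L2R) : ℝ → ℂ) =ᵐ[volume] (Icc (-lam) lam).indicator fun _ ↦ (1 : ℂ) := by
  have h1 := cutoffProj_coeFn lam (schwartzToL2 (testBump lam hlam))
  have h2 : ((schwartzToL2 (testBump lam hlam) : L2R) : ℝ → ℂ) =ᵐ[volume] testBump lam hlam :=
    (testBump lam hlam).coeFn_toLp 2 volume
  filter_upwards [h1, h2] with x hx1 hx2
  rw [betaPlus, hx1]
  by_cases hx : x ∈ Icc (-lam) lam
  · rw [indicator_of_mem hx, indicator_of_mem hx, hx2, testBump_apply,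
      testBumpFun_eq_one hlam (by rw [abs_le]; constructor <;> linarith [hx.1, hx.2])]
  · rw [indicator_of_notMem hx, indicator_of_notMem hx]

/-- `β_- = x·1_{[−λ,λ]}` a.e. [cite: ConnesMoscovici2022, Lemma 1.5 setup (= arXiv:2112.05500 chunk p0005:L88)] -/
theorem betaMinus_coeFn (hlam : 0 < lam) :
    ((betaMinus lam hlam : L2R) : ℝ → ℂ) =ᵐ[volume] (Icc (-lam) lam).indicator fun x ↦ (x : ℂ) := by
  have h1 := cutoffProj_coeFn lam (schwartzToL2 (testBumpX lam hlam))
  have h2 : ((schwartzToL2 (testBumpX lam hlam) : L2R) : ℝ → ℂ) =ᵐ[volume] testBumpX lam hlam :=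
    (testBumpX lam hlam).coeFn_toLp 2 volume
  filter_upwards [h1, h2] with x hx1 hx2
  rw [betaMinus, hx1]
  by_cases hx : x ∈ Icc (-lam) lam
  · rw [indicator_of_mem hx, indicator_of_mem hx, hx2, testBumpX_apply,
      testBumpFun_eq_one hlam (by rw [abs_le]; constructor <;> linarith [hx.1, hx.2]), mul_one]
  · rw [indicator_of_notMem hx, indicator_of_notMem hx]

/-- The Schwartz core lies in `dom W_min`. [cite: ConnesMoscovici2022, §1 ¶1 (= arXiv:2112.05500 chunk p0004:L13–L16)] -/
theorem schwartzToL2_mem_prolateMin (lam : ℝ) (f : 𝓢(ℝ, ℂ)) :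
    schwartzToL2 f ∈ (prolateMin lam).domain :=
  (prolateCore lam).le_closure.1 (LinearMap.mem_range_self _ f)

/-- `W_min` on the core is `W`. [cite: ConnesMoscovici2022, §1 ¶1 (= arXiv:2112.05500 chunk p0004:L13–L16)] -/
theorem prolateMin_schwartzToL2 (lam : ℝ) (f : 𝓢(ℝ, ℂ)) :
    prolateMin lam ⟨schwartzToL2 f, schwartzToL2_mem_prolateMin lam f⟩ =
      schwartzToL2 (prolateSchwartz lam f) := by
  have h := (prolateCore lam).le_closure.2
    (x := ⟨schwartzToL2 f, LinearMap.mem_range_self _ f⟩)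
    (y := ⟨schwartzToL2 f, schwartzToL2_mem_prolateMin lam f⟩) rfl
  rw [← prolateCore_apply]
  exact h.symm

/-- **`β_+ ∈ dom W_max` and `W_max β_+ = P_λ (W f_+)`** (Lemma 1.3). [cite: ConnesMoscovici2022, Lemma 1.3 and Lemma 1.5 setup (= arXiv:2112.05500 chunks p0004:L106, p0005:L86)] -/
theorem betaPlus_mem_prolateMax (hlam : 0 < lam) :
    ∃ h : betaPlus lam hlam ∈ (prolateMax lam).domain,
      prolateMax lam ⟨betaPlus lam hlam, h⟩ =
        cutoffProj lam (schwartzToL2 (prolateSchwartz lam (testBump lam hlam))) := by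
  obtain ⟨h, h'⟩ := cutoffProj_mem_prolateMax lam hlam
    ⟨schwartzToL2 (testBump lam hlam), schwartzToL2_mem_prolateMin lam _⟩
  refine ⟨h, ?_⟩
  change prolateMax lam ⟨cutoffProj lam (schwartzToL2 (testBump lam hlam)), h⟩ = _
  rw [h', prolateMin_schwartzToL2]

/-- **`β_- ∈ dom W_max` and `W_max β_- = P_λ (W f_-)`** (Lemma 1.3). [cite: ConnesMoscovici2022, Lemma 1.3 and Lemma 1.5 setup (= arXiv:2112.05500 chunks p0004:L106, p0005:L88)] -/
theorem betaMinus_mem_prolateMax (hlam : 0 < lam) :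
    ∃ h : betaMinus lam hlam ∈ (prolateMax lam).domain,
      prolateMax lam ⟨betaMinus lam hlam, h⟩ =
        cutoffProj lam (schwartzToL2 (prolateSchwartz lam (testBumpX lam hlam))) := by
  obtain ⟨h, h'⟩ := cutoffProj_mem_prolateMax lam hlam
    ⟨schwartzToL2 (testBumpX lam hlam), schwartzToL2_mem_prolateMin lam _⟩
  refine ⟨h, ?_⟩
  change prolateMax lam ⟨cutoffProj lam (schwartzToL2 (testBumpX lam hlam)), h⟩ = _
  rw [h', prolateMin_schwartzToL2]

/-- `W_max β_+` vanishes a.e. outside `I`. [cite: ConnesMoscovici2022, Lemma 1.3 (= arXiv:2112.05500 chunk p0004:L106–L120)] -/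
theorem prolateMax_betaPlus_coeFn_eq_zero (hlam : 0 < lam) :
    ∀ᵐ x : ℝ, x ∉ Icc (-lam) lam →
      ((prolateMax lam ⟨betaPlus lam hlam, (betaPlus_mem_prolateMax hlam).1⟩ : L2R) : ℝ → ℂ) x
        = 0 := by
  obtain ⟨h, h'⟩ := betaPlus_mem_prolateMax hlam
  rw [h']
  filter_upwards [cutoffProj_coeFn lam (schwartzToL2 (prolateSchwartz lam (testBump lam hlam)))]
    with x hx hxI
  rw [hx, indicator_of_notMem hxI]

/-- `W_max β_-` vanishes a.e. outside `I`. [cite: ConnesMoscovici2022, Lemma 1.3 (= arXiv:2112.05500 chunk p0004:L106–L120)] -/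
theorem prolateMax_betaMinus_coeFn_eq_zero (hlam : 0 < lam) :
    ∀ᵐ x : ℝ, x ∉ Icc (-lam) lam →
      ((prolateMax lam ⟨betaMinus lam hlam, (betaMinus_mem_prolateMax hlam).1⟩ : L2R) : ℝ → ℂ) x
        = 0 := by
  obtain ⟨h, h'⟩ := betaMinus_mem_prolateMax hlam
  rw [h']
  filter_upwards [cutoffProj_coeFn lam (schwartzToL2 (prolateSchwartz lam (testBumpX lam hlam)))]
    with x hx hxI
  rw [hx, indicator_of_notMem hxI]


/-! ## §2. The explicit Fourier transforms `φ_+ = 𝓕β_+`, `φ_- = 𝓕β_-` -/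

/-- **`φ_+(y) = sin(2πλy)/(πy) = 2λ·sinc(2πλy)`**, the smooth representative of `𝓕β_+ = 𝔽_{e_ℝ} 1_I`
(Lemma 1.4 (ii)), extended by `2λ` at `y = 0`. [cite: ConnesMoscovici2022, Lemma 1.4 (ii) (= arXiv:2112.05500 chunk p0005:L75–L76)] -/
def phiPlus (lam : ℝ) (y : ℝ) : ℂ := ((2 * lam * Real.sinc (2 * π * lam * y) : ℝ) : ℂ)

/-- `φ_+` is smooth on `ℝ` (tree `contDiff_sinc`). [cite: ConnesMoscovici2022, Lemma 1.4 (ii) (= arXiv:2112.05500 chunk p0005:L75–L76)] -/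
theorem contDiff_phiPlus (lam : ℝ) : ContDiff ℝ ((⊤ : ℕ∞) : WithTop ℕ∞) (phiPlus lam) := by
  have h1 : ContDiff ℝ ((⊤ : ℕ∞) : WithTop ℕ∞) fun y : ℝ ↦ 2 * lam * Real.sinc (2 * π * lam * y) :=
    contDiff_const.mul (Literature.Analysis.Fourier.contDiff_sinc.comp
      (contDiff_const.mul contDiff_id))
  exact ofRealCLM.contDiff.comp h1

/-- `φ_+` is `C^n` for every `n`. [cite: ConnesMoscovici2022, Lemma 1.4 (ii) (= arXiv:2112.05500 chunk p0005:L75–L76)] -/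
theorem contDiff_phiPlus_nat (lam : ℝ) (n : ℕ) : ContDiff ℝ n (phiPlus lam) :=
  (contDiff_phiPlus lam).of_le (by exact_mod_cast le_top)

/-- `φ_+` for `y ≠ 0`. [cite: ConnesMoscovici2022, Lemma 1.4 (ii) (= arXiv:2112.05500 chunk p0005:L75–L76)] -/
theorem phiPlus_of_ne_zero (hlam : 0 < lam) {y : ℝ} (hy : y ≠ 0) :
    phiPlus lam y = ((Real.sin (2 * π * lam * y) / (π * y) : ℝ) : ℂ) := by
  have hne : 2 * π * lam * y ≠ 0 := by positivity
  rw [phiPlus, Real.sinc_of_ne_zero hne]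
  congr 1
  field_simp

/-- `φ_+` is even. [cite: ConnesMoscovici2022, Lemma 1.4 (ii) (= arXiv:2112.05500 chunk p0005:L75–L76)] -/
theorem phiPlus_neg (lam y : ℝ) : phiPlus lam (-y) = phiPlus lam y := by
  simp [phiPlus, mul_neg, Real.sinc_neg]

/-- The derivative of `φ_+` off `0`: `φ_+′(y) = (2πλy cos(2πλy) − sin(2πλy))/(πy²)`.
[cite: ConnesMoscovici2022, Lemma 1.5 proof "`β̂_- = (i/2π)∂β̂_+`" (= arXiv:2112.05500 chunk p0005:L96)] -/
theorem hasDerivAt_phiPlus_of_ne_zero (hlam : 0 < lam) {y : ℝ} (hy : y ≠ 0) :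
    HasDerivAt (phiPlus lam)
      (((2 * π * lam * y * Real.cos (2 * π * lam * y) - Real.sin (2 * π * lam * y)) / (π * y ^ 2)
        : ℝ) : ℂ) y := by
  -- `φ_+` agrees near `y` with the explicit quotient
  have hev : phiPlus lam =ᶠ[𝓝 y] fun t : ℝ ↦ ((Real.sin (2 * π * lam * t) / (π * t) : ℝ) : ℂ) := by
    filter_upwards [isOpen_ne.mem_nhds hy] with t ht
    exact phiPlus_of_ne_zero hlam ht
  have hπy : π * y ≠ 0 := mul_ne_zero Real.pi_ne_zero hy
  have hnum : HasDerivAt (fun t : ℝ ↦ Real.sin (2 * π * lam * t))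
      (Real.cos (2 * π * lam * y) * (2 * π * lam * 1)) y :=
    ((hasDerivAt_id y).const_mul (2 * π * lam)).sin
  have hden : HasDerivAt (fun t : ℝ ↦ π * t) (π * 1) y := (hasDerivAt_id y).const_mul π
  have hq := hnum.div hden hπy
  refine ((hq.ofReal_comp).congr_of_eventuallyEq hev).congr_deriv ?_
  push_cast
  have hπ : (π : ℂ) ≠ 0 := by exact_mod_cast Real.pi_ne_zero
  have hy' : (y : ℂ) ≠ 0 := by exact_mod_cast hy
  field_simp

/-- `φ_+′` off `0`. [cite: ConnesMoscovici2022, Lemma 1.5 proof (= arXiv:2112.05500 chunk p0005:L96)] -/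
theorem deriv_phiPlus_of_ne_zero (hlam : 0 < lam) {y : ℝ} (hy : y ≠ 0) :
    deriv (phiPlus lam) y =
      (((2 * π * lam * y * Real.cos (2 * π * lam * y) - Real.sin (2 * π * lam * y)) / (π * y ^ 2)
        : ℝ) : ℂ) :=
  (hasDerivAt_phiPlus_of_ne_zero hlam hy).deriv

/-- **`φ_- := (i/2π) φ_+′`**, the smooth representative of `𝓕β_- = 𝔽_{e_ℝ}(x·1_I)`
("`β̂_-(x) = (i/2π)∂_x β̂_+(x)`"). [cite: ConnesMoscovici2022, Lemma 1.5 proof (= arXiv:2112.05500 chunk p0005:L96)] -/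
def phiMinus (lam : ℝ) (y : ℝ) : ℂ := I / (2 * π) * deriv (phiPlus lam) y

/-- `φ_-` is `C²`. [cite: ConnesMoscovici2022, Lemma 1.5 proof (= arXiv:2112.05500 chunk p0005:L96)] -/
theorem contDiff_phiMinus (lam : ℝ) : ContDiff ℝ 2 (phiMinus lam) := by
  have h3 : ContDiff ℝ (2 + 1) (phiPlus lam) := contDiff_phiPlus_nat lam 3
  have hd : ContDiff ℝ 2 (deriv (phiPlus lam)) := (contDiff_succ_iff_deriv.mp h3).2.2
  exact contDiff_const.mul hd

/-- `φ_-` for `y ≠ 0`: `φ_-(y) = i(2πλy cos(2πλy) − sin(2πλy))/(2π²y²)`.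
[cite: ConnesMoscovici2022, Lemma 1.5 proof (= arXiv:2112.05500 chunk p0005:L96)] -/
theorem phiMinus_of_ne_zero (hlam : 0 < lam) {y : ℝ} (hy : y ≠ 0) :
    phiMinus lam y =
      I * (((2 * π * lam * y * Real.cos (2 * π * lam * y) - Real.sin (2 * π * lam * y)) /
        (2 * π ^ 2 * y ^ 2) : ℝ) : ℂ) := by
  rw [phiMinus, deriv_phiPlus_of_ne_zero hlam hy]
  have hπ : (π : ℂ) ≠ 0 := by exact_mod_cast Real.pi_ne_zero
  have hy' : (y : ℂ) ≠ 0 := by exact_mod_cast hy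
  push_cast
  field_simp

/-- `φ_-` is odd (the derivative of the even `φ_+`). [cite: ConnesMoscovici2022, Lemma 1.5 proof (= arXiv:2112.05500 chunk p0005:L96)] -/
theorem phiMinus_neg (lam y : ℝ) : phiMinus lam (-y) = -phiMinus lam y := by
  have he : (fun t : ℝ ↦ phiPlus lam (-t)) = phiPlus lam := funext (phiPlus_neg lam)
  have hd : deriv (phiPlus lam) (-y) = -deriv (phiPlus lam) y := by
    have := deriv_comp_neg (f := phiPlus lam) y
    rw [he] at this
    rw [this, neg_neg]
  rw [phiMinus, phiMinus, hd, mul_neg]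

/-! ### `𝓕 β_+ = φ_+` and `𝓕 β_- = φ_-` almost everywhere -/

/-- `x ≠ 0, ±λ` almost everywhere. [folklore] -/
private theorem ae_ne_three (lam : ℝ) : ∀ᵐ x : ℝ, x ≠ 0 ∧ x ≠ lam ∧ x ≠ -lam := by
  have h : (({0, lam, -lam} : Set ℝ))ᶜ ∈ ae (volume : Measure ℝ) :=
    compl_mem_ae_iff.mpr ((Set.toFinite _).measure_zero volume)
  filter_upwards [h] with x hx
  simpa [not_or] using hx

/-- `β_+` is the `L²` class of `1_I`. [cite: ConnesMoscovici2022, Lemma 1.5 setup (= arXiv:2112.05500 chunk p0005:L86)] -/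
theorem memLp_indicator_one (lam : ℝ) :
    MemLp ((Icc (-lam) lam).indicator fun _ : ℝ ↦ (1 : ℂ)) 2 (volume : Measure ℝ) :=
  memLp_indicator_const 2 measurableSet_Icc (1 : ℂ) (Or.inr measure_Icc_lt_top.ne)

/-- `1_I ∈ L¹`. [cite: ConnesMoscovici2022, Lemma 1.5 setup (= arXiv:2112.05500 chunk p0005:L86)] -/
theorem integrable_indicator_one (lam : ℝ) :
    Integrable ((Icc (-lam) lam).indicator fun _ : ℝ ↦ (1 : ℂ)) (volume : Measure ℝ) :=
  memLp_one_iff_integrable.mp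
    (memLp_indicator_const 1 measurableSet_Icc (1 : ℂ) (Or.inr measure_Icc_lt_top.ne))

/-- `β_+` is the `L²` class of `1_I`. [cite: ConnesMoscovici2022, Lemma 1.5 setup (= arXiv:2112.05500 chunk p0005:L86)] -/
theorem betaPlus_eq_toLp (hlam : 0 < lam) :
    betaPlus lam hlam = (memLp_indicator_one lam).toLp _ :=
  Lp.ext ((betaPlus_coeFn hlam).trans (MemLp.coeFn_toLp _).symm)

/-- **`𝓕 β_+ = φ_+` a.e.** (Lemma 1.4 (ii) on `L²`). [cite: ConnesMoscovici2022, Lemma 1.4 (ii) (= arXiv:2112.05500 chunk p0005:L75–L76)] -/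
theorem fourier_betaPlus_coeFn (hlam : 0 < lam) :
    ((𝓕 (betaPlus lam hlam) : L2R) : ℝ → ℂ) =ᵐ[volume] phiPlus lam := by
  rw [betaPlus_eq_toLp hlam]
  filter_upwards [Literature.Analysis.FunctionSpaces.fourier_toLp_ae_eq_fourierIntegral
    (integrable_indicator_one lam) (memLp_indicator_one lam), ae_ne_three lam] with y hy hy0
  rw [hy, CM22_lemma_1_4_ii lam hlam hy0.1, phiPlus_of_ne_zero hlam hy0.1]

/-- `‖x·1_I‖ ≤ ‖λ·1_I‖` pointwise. [folklore] -/
private theorem norm_indicator_x_le (hlam : 0 < lam) (x : ℝ) :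
    ‖(Icc (-lam) lam).indicator (fun x : ℝ ↦ (x : ℂ)) x‖ ≤
      ‖(Icc (-lam) lam).indicator (fun _ : ℝ ↦ ((lam : ℝ) : ℂ)) x‖ := by
  by_cases hx : x ∈ Icc (-lam) lam
  · rw [indicator_of_mem hx, indicator_of_mem hx, Complex.norm_real, Complex.norm_real,
      Real.norm_eq_abs, Real.norm_eq_abs, abs_of_pos hlam, abs_le]
    exact ⟨hx.1, hx.2⟩
  · rw [indicator_of_notMem hx, indicator_of_notMem hx]

/-- Measurability of `x·1_I`. [folklore] -/
private theorem aestronglyMeasurable_indicator_x (lam : ℝ) :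
    AEStronglyMeasurable ((Icc (-lam) lam).indicator fun x : ℝ ↦ (x : ℂ)) (volume : Measure ℝ) :=
  (Complex.continuous_ofReal.aestronglyMeasurable).indicator measurableSet_Icc

/-- The class `x·1_I` is in `L²`. [cite: ConnesMoscovici2022, Lemma 1.5 setup (= arXiv:2112.05500 chunk p0005:L88)] -/
theorem memLp_indicator_x (hlam : 0 < lam) :
    MemLp ((Icc (-lam) lam).indicator fun x : ℝ ↦ (x : ℂ)) 2 (volume : Measure ℝ) :=
  MemLp.of_le (memLp_indicator_const 2 measurableSet_Icc ((lam : ℝ) : ℂ) (Or.inr measure_Icc_lt_top.ne))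
    (aestronglyMeasurable_indicator_x lam) (ae_of_all _ (norm_indicator_x_le hlam))

/-- The class `x·1_I` is in `L¹`. [cite: ConnesMoscovici2022, Lemma 1.5 setup (= arXiv:2112.05500 chunk p0005:L88)] -/
theorem integrable_indicator_x (hlam : 0 < lam) :
    Integrable ((Icc (-lam) lam).indicator fun x : ℝ ↦ (x : ℂ)) (volume : Measure ℝ) :=
  memLp_one_iff_integrable.mp
    (MemLp.of_le (memLp_indicator_const 1 measurableSet_Icc ((lam : ℝ) : ℂ)
      (Or.inr measure_Icc_lt_top.ne))
      (aestronglyMeasurable_indicator_x lam) (ae_of_all _ (norm_indicator_x_le hlam)))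

/-- `β_-` is the `L²` class of `x·1_I`. [cite: ConnesMoscovici2022, Lemma 1.5 setup (= arXiv:2112.05500 chunk p0005:L88)] -/
theorem betaMinus_eq_toLp (hlam : 0 < lam) :
    betaMinus lam hlam = (memLp_indicator_x hlam).toLp _ :=
  Lp.ext ((betaMinus_coeFn hlam).trans (MemLp.coeFn_toLp _).symm)

/-- Scalars pull out of the Fourier integral. [folklore] -/
private theorem fourierFun_const_smul (r : ℂ) (f : ℝ → ℂ) : 𝓕 (r • f) = r • 𝓕 f :=
  VectorFourier.fourierIntegral_const_smul _ _ _ _ _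

/-- **The Fourier integral of `x·1_I` is `φ_-`** off `0`: `𝔽(x 1_I) = (i/2π) ∂ 𝔽(1_I)` (Mathlib
`Real.hasDerivAt_fourier`) and `𝔽(1_I) = φ_+` near any `y ≠ 0` (Lemma 1.4 (ii)).
[cite: ConnesMoscovici2022, Lemma 1.4 (ii) and Lemma 1.5 proof (= arXiv:2112.05500 chunks p0005:L75–L76, L96)] -/
theorem fourierIntegral_indicator_x (hlam : 0 < lam) {y : ℝ} (hy : y ≠ 0) :
    𝓕 ((Icc (-lam) lam).indicator fun x : ℝ ↦ (x : ℂ)) y = phiMinus lam y := by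
  set f : ℝ → ℂ := (Icc (-lam) lam).indicator fun _ : ℝ ↦ (1 : ℂ) with hf
  set g : ℝ → ℂ := (Icc (-lam) lam).indicator fun x : ℝ ↦ (x : ℂ) with hg
  have hxf : (fun x : ℝ ↦ x • f x) = g := by
    funext x
    by_cases hx : x ∈ Icc (-lam) lam
    · simp [hf, hg, indicator_of_mem hx]
    · simp [hf, hg, indicator_of_notMem hx]
  have hD := Real.hasDerivAt_fourier (integrable_indicator_one lam)
    (by rw [hxf]; exact integrable_indicator_x hlam) y
  -- `x ↦ (-2πI x) • f x = (-2πI) • g`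
  have hsm : (fun x : ℝ ↦ (-2 * π * I * x) • f x) = (-2 * π * I) • g := by
    funext x
    by_cases hx : x ∈ Icc (-lam) lam
    · simp [hf, hg, indicator_of_mem hx]
    · simp [hf, hg, indicator_of_notMem hx]
  rw [hsm, fourierFun_const_smul] at hD
  -- `𝓕 f = φ_+` near `y`, so the derivatives agree
  have hev : 𝓕 f =ᶠ[𝓝 y] phiPlus lam := by
    filter_upwards [isOpen_ne.mem_nhds hy] with t ht
    rw [hf, CM22_lemma_1_4_ii lam hlam ht, phiPlus_of_ne_zero hlam ht]
  have hD' : HasDerivAt (phiPlus lam) (((-2 * π * I) • 𝓕 g) y) y := hD.congr_of_eventuallyEq hev.symm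
  have hderiv : deriv (phiPlus lam) y = (-2 * π * I) * 𝓕 g y := by
    rw [hD'.deriv]; rfl
  rw [phiMinus, hderiv]
  have hπ : (π : ℂ) ≠ 0 := by exact_mod_cast Real.pi_ne_zero
  field_simp
  ring_nf
  rw [I_sq]
  ring

/-- **`𝓕 β_- = φ_-` a.e.** [cite: ConnesMoscovici2022, Lemma 1.5 proof "`β̂_- = (i/2π)∂β̂_+`" (= arXiv:2112.05500 chunk p0005:L96)] -/
theorem fourier_betaMinus_coeFn (hlam : 0 < lam) :
    ((𝓕 (betaMinus lam hlam) : L2R) : ℝ → ℂ) =ᵐ[volume] phiMinus lam := by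
  rw [betaMinus_eq_toLp hlam]
  filter_upwards [Literature.Analysis.FunctionSpaces.fourier_toLp_ae_eq_fourierIntegral
    (integrable_indicator_x hlam) (memLp_indicator_x hlam), ae_ne_three lam] with y hy hy0
  rw [hy, fourierIntegral_indicator_x hlam hy0.1]

/-! ### Parity: `𝓕⁻¹β_+ = 𝓕β_+`, `𝓕⁻¹β_- = −𝓕β_-` -/

/-- `β_+` is even: `R β_+ = β_+`. [cite: ConnesMoscovici2022, Lemma 1.5 setup (= arXiv:2112.05500 chunk p0005:L86)] -/
theorem compNeg_betaPlus (hlam : 0 < lam) :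
    Lp.compMeasurePreserving (fun x : ℝ ↦ -x) (Measure.measurePreserving_neg volume)
      (betaPlus lam hlam) = betaPlus lam hlam := by
  have hq : Measure.QuasiMeasurePreserving (fun x : ℝ ↦ -x) volume volume :=
    (Measure.measurePreserving_neg (volume : Measure ℝ)).quasiMeasurePreserving
  apply Lp.ext
  filter_upwards [Literature.Analysis.Fourier.coeFn_compNeg (betaPlus lam hlam),
    hq.ae_eq (betaPlus_coeFn hlam), betaPlus_coeFn hlam] with x h1 h2 h3
  rw [h1]
  change ((betaPlus lam hlam : L2R) : ℝ → ℂ) (-x) = _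
  have h2' : ((betaPlus lam hlam : L2R) : ℝ → ℂ) (-x) =
      (Icc (-lam) lam).indicator (fun _ : ℝ ↦ (1 : ℂ)) (-x) := h2
  rw [h2', h3]
  have hiff : -x ∈ Icc (-lam) lam ↔ x ∈ Icc (-lam) lam := by
    simp only [mem_Icc]; constructor <;> rintro ⟨h₁, h₂⟩ <;> constructor <;> linarith
  by_cases hx : x ∈ Icc (-lam) lam
  · rw [indicator_of_mem hx, indicator_of_mem (hiff.mpr hx)]
  · rw [indicator_of_notMem hx, indicator_of_notMem (fun h ↦ hx (hiff.mp h))]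

/-- `β_-` is odd: `R β_- = −β_-`. [cite: ConnesMoscovici2022, Lemma 1.5 setup (= arXiv:2112.05500 chunk p0005:L88)] -/
theorem compNeg_betaMinus (hlam : 0 < lam) :
    Lp.compMeasurePreserving (fun x : ℝ ↦ -x) (Measure.measurePreserving_neg volume)
      (betaMinus lam hlam) = -betaMinus lam hlam := by
  have hq : Measure.QuasiMeasurePreserving (fun x : ℝ ↦ -x) volume volume :=
    (Measure.measurePreserving_neg (volume : Measure ℝ)).quasiMeasurePreserving
  apply Lp.ext
  filter_upwards [Literature.Analysis.Fourier.coeFn_compNeg (betaMinus lam hlam),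
    hq.ae_eq (betaMinus_coeFn hlam), betaMinus_coeFn hlam, Lp.coeFn_neg (betaMinus lam hlam)]
    with x h1 h2 h3 h4
  rw [h1, h4, Pi.neg_apply, h3]
  change ((betaMinus lam hlam : L2R) : ℝ → ℂ) (-x) = _
  have h2' : ((betaMinus lam hlam : L2R) : ℝ → ℂ) (-x) =
      (Icc (-lam) lam).indicator (fun x : ℝ ↦ (x : ℂ)) (-x) := h2
  rw [h2']
  have hiff : -x ∈ Icc (-lam) lam ↔ x ∈ Icc (-lam) lam := by
    simp only [mem_Icc]; constructor <;> rintro ⟨h₁, h₂⟩ <;> constructor <;> linarith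
  by_cases hx : x ∈ Icc (-lam) lam
  · rw [indicator_of_mem hx, indicator_of_mem (hiff.mpr hx)]; push_cast; ring
  · rw [indicator_of_notMem hx, indicator_of_notMem (fun h ↦ hx (hiff.mp h)), neg_zero]

/-- **`𝓕⁻¹ β_+ = 𝓕 β_+`** (`β_+` even). [cite: ConnesMoscovici2022, Thm 1.6 proof, 𝓕-invariance step (= arXiv:2112.05500 chunk p0006:L38–L44)] -/
theorem fourierInv_betaPlus (hlam : 0 < lam) :
    (𝓕⁻ (betaPlus lam hlam) : L2R) = 𝓕 (betaPlus lam hlam) := by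
  rw [Literature.Analysis.Fourier.fourierInv_eq_fourier_compNeg, compNeg_betaPlus]

/-- **`𝓕⁻¹ β_- = −𝓕 β_-`** (`β_-` odd). [cite: ConnesMoscovici2022, Thm 1.6 proof, 𝓕-invariance step (= arXiv:2112.05500 chunk p0006:L38–L44)] -/
theorem fourierInv_betaMinus (hlam : 0 < lam) :
    (𝓕⁻ (betaMinus lam hlam) : L2R) = -𝓕 (betaMinus lam hlam) := by
  rw [Literature.Analysis.Fourier.fourierInv_eq_fourier_compNeg, compNeg_betaMinus,
    ← neg_one_smul ℂ (betaMinus lam hlam), fourier_smul, neg_one_smul]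

/-! ## §3. Parity bookkeeping for the boundary expressions at `±∞` -/

/-- For an even `f`, the expression (1.20) is odd in `x`. [cite: ConnesMoscovici2022, §1 boundary condition (1.20) (= arXiv:2112.05500 (2.20), chunk p0006:L64–L66)] -/
theorem bcInfEven_neg_of_even (lam : ℝ) {f : ℝ → ℂ} (hf : ∀ x, f (-x) = f x) (x : ℝ) :
    bcInfEven lam f (-x) = -bcInfEven lam f x := by
  have he : (fun t : ℝ ↦ f (-t)) = f := funext hf
  have hd : deriv f (-x) = -deriv f x := by
    have h := deriv_comp_neg (f := f) x
    rw [he] at h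
    rw [h, neg_neg]
  simp only [bcInfEven, hf, hd, mul_neg, Real.sin_neg, Real.cos_neg, neg_mul, neg_neg, sub_neg_eq_add]
  push_cast
  ring

/-- For an odd `f`, the expression (1.21) is odd in `x`. [cite: ConnesMoscovici2022, §1 boundary condition (1.21) (= arXiv:2112.05500 (2.21), chunk p0006:L67–L69)] -/
theorem bcInfOdd_neg_of_odd (lam : ℝ) {f : ℝ → ℂ} (hf : ∀ x, f (-x) = -f x) (x : ℝ) :
    bcInfOdd lam f (-x) = -bcInfOdd lam f x := by
  have he : (fun t : ℝ ↦ f (-t)) = fun t ↦ -f t := funext hf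
  have hd : deriv f (-x) = deriv f x := by
    have h := deriv_comp_neg (f := f) x
    rw [he] at h
    change deriv (-f) x = -deriv f (-x) at h
    rw [deriv.neg] at h
    have := neg_injective h
    exact this.symm
  simp only [bcInfOdd, hf, hd, mul_neg, Real.sin_neg, Real.cos_neg, neg_mul, neg_neg]
  push_cast
  ring

/-- An odd function tending to `0` at `+∞` tends to `0` at `−∞` (how (1.20)/(1.21) at `−∞` follow from `+∞` by parity). [cite: ConnesMoscovici2022, §1 boundary conditions (1.20)–(1.21) (= arXiv:2112.05500 chunk p0006:L64–L69)] -/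
theorem tendsto_atBot_zero_of_odd {F : ℝ → ℂ} (hodd : ∀ x, F (-x) = -F x)
    (h : Tendsto F atTop (𝓝 0)) : Tendsto F atBot (𝓝 0) := by
  have h1 : Tendsto (fun x ↦ F (-x)) atBot (𝓝 0) := h.comp tendsto_neg_atBot_atTop
  have h2 : Tendsto (fun x ↦ -F (-x)) atBot (𝓝 0) := by simpa using h1.neg
  refine h2.congr fun x ↦ ?_
  rw [hodd, neg_neg]

/-- The even part of an even function is the function. [cite: ConnesMoscovici2022, §1 text before Thm 1.6, `ξ = ξ⁺ + ξ⁻` (= arXiv:2112.05500 chunk p0006:L60)] -/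
theorem evenFn_eq_self_of_even {f : ℝ → ℂ} (hf : ∀ x, f (-x) = f x) : evenFn f = f := by
  funext x; simp only [evenFn, hf]; ring

/-- The odd part of an even function vanishes. [cite: ConnesMoscovici2022, §1 text before Thm 1.6, `ξ = ξ⁺ + ξ⁻` (= arXiv:2112.05500 chunk p0006:L60)] -/
theorem oddFn_eq_zero_of_even {f : ℝ → ℂ} (hf : ∀ x, f (-x) = f x) : oddFn f = fun _ ↦ 0 := by
  funext x; simp only [oddFn, hf]; ring

/-- The odd part of an odd function is the function. [cite: ConnesMoscovici2022, §1 text before Thm 1.6, `ξ = ξ⁺ + ξ⁻` (= arXiv:2112.05500 chunk p0006:L60)] -/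
theorem oddFn_eq_self_of_odd {f : ℝ → ℂ} (hf : ∀ x, f (-x) = -f x) : oddFn f = f := by
  funext x; simp only [oddFn, hf]; ring

/-- The even part of an odd function vanishes. [cite: ConnesMoscovici2022, §1 text before Thm 1.6, `ξ = ξ⁺ + ξ⁻` (= arXiv:2112.05500 chunk p0006:L60)] -/
theorem evenFn_eq_zero_of_odd {f : ℝ → ℂ} (hf : ∀ x, f (-x) = -f x) : evenFn f = fun _ ↦ 0 := by
  funext x; simp only [evenFn, hf]; ring

/-- (1.20) on the zero function. [cite: ConnesMoscovici2022, §1 boundary conditions (1.20)–(1.21) (= arXiv:2112.05500 chunk p0006:L64–L69)] -/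
theorem bcInfEven_zero (lam : ℝ) : bcInfEven lam (fun _ : ℝ ↦ (0 : ℂ)) = fun _ ↦ 0 := by
  funext x; simp [bcInfEven]

/-- (1.21) on the zero function. [cite: ConnesMoscovici2022, §1 boundary conditions (1.20)–(1.21) (= arXiv:2112.05500 chunk p0006:L64–L69)] -/
theorem bcInfOdd_zero (lam : ℝ) : bcInfOdd lam (fun _ : ℝ ↦ (0 : ℂ)) = fun _ ↦ 0 := by
  funext x; simp [bcInfOdd]

/-! ## §4. The four test vectors lie in `𝓛_β` -/

/-- `p(λ) = 0`. [cite: ConnesMoscovici2022, §1 boundary condition (1.19) (= arXiv:2112.05500 chunk p0006:L62)] -/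
private theorem pCoeff_at_lam (lam : ℝ) : pCoeff lam lam = 0 := by simp [pCoeff]

/-- `p(−λ) = 0`. [cite: ConnesMoscovici2022, §1 boundary condition (1.19) (= arXiv:2112.05500 chunk p0006:L62)] -/
private theorem pCoeff_at_neg_lam (lam : ℝ) : pCoeff lam (-lam) = 0 := by simp [pCoeff]

/-- `1_{(−λ,λ)} = 1_{[−λ,λ]}`-type a.e. equalities: the two indicators agree off `{±λ}`. [folklore] -/
private theorem indicator_Ioo_eq_Icc_of_ne {x : ℝ} (hx : x ≠ lam ∧ x ≠ -lam) (f : ℝ → ℂ) :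
    (Ioo (-lam) lam).indicator f x = (Icc (-lam) lam).indicator f x := by
  by_cases h : x ∈ Ioo (-lam) lam
  · rw [indicator_of_mem h, indicator_of_mem (Ioo_subset_Icc_self h)]
  · have h' : x ∉ Icc (-lam) lam := fun h'' ↦
      h ⟨lt_of_le_of_ne h''.1 (Ne.symm hx.2), lt_of_le_of_ne h''.2 hx.1⟩
    rw [indicator_of_notMem h', indicator_of_notMem h]

/-- **`β_+ ∈ 𝓛_β`** (representative `1_{(−λ,λ)}`; (1.19) trivially, (1.20)–(1.21) by compact support).
[cite: ConnesMoscovici2022, Thm 1.6 proof "(ii) … every element of 𝓛_β is a linear combination of an element ξ ∈ dom W_min and the 4 vectors β_±, β̂_±" (= arXiv:2112.05500 chunk p0006:L83–L85)] -/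
theorem betaPlus_mem_prolateSASet (hlam : 0 < lam) : betaPlus lam hlam ∈ prolateSASet lam := by
  refine ⟨(betaPlus_mem_prolateMax hlam).1, (Ioo (-lam) lam).indicator fun _ ↦ (1 : ℂ), ?_, ?_⟩
  · filter_upwards [betaPlus_coeFn hlam, ae_ne_three lam] with x hx hx0
    rw [hx, indicator_Ioo_eq_Icc_of_ne hx0.2]
  · refine ProlateBC.indicator_Ioo hlam (g := fun _ : ℝ ↦ (1 : ℂ)) (differentiableOn_const _) ?_ ?_
    · simp only [deriv_const', mul_zero]; exact tendsto_const_nhds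
    · simp only [deriv_const', mul_zero]; exact tendsto_const_nhds

/-- **`β_- ∈ 𝓛_β`** (representative `x·1_{(−λ,λ)}`; (1.19) because `p·1 → 0`).
[cite: ConnesMoscovici2022, Thm 1.6 proof (= arXiv:2112.05500 chunk p0006:L83–L85)] -/
theorem betaMinus_mem_prolateSASet (hlam : 0 < lam) : betaMinus lam hlam ∈ prolateSASet lam := by
  refine ⟨(betaMinus_mem_prolateMax hlam).1, (Ioo (-lam) lam).indicator fun x : ℝ ↦ (x : ℂ), ?_, ?_⟩
  · filter_upwards [betaMinus_coeFn hlam, ae_ne_three lam] with x hx hx0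
    rw [hx, indicator_Ioo_eq_Icc_of_ne hx0.2]
  · have hd : ∀ x : ℝ, deriv (fun t : ℝ ↦ (t : ℂ)) x = 1 := fun x ↦ by
      simpa using ((hasDerivAt_id x).ofReal_comp).deriv
    have hdiff : DifferentiableOn ℝ (fun t : ℝ ↦ (t : ℂ)) {x | x ≠ lam ∧ x ≠ -lam} :=
      fun x _ ↦ ((hasDerivAt_id x).ofReal_comp).differentiableAt.differentiableWithinAt
    refine ProlateBC.indicator_Ioo hlam hdiff ?_ ?_
    · simp only [hd, mul_one]
      have := ((continuous_pCoeff_def lam).tendsto lam).mono_left (nhdsWithin_le_nhds (s := Iio lam))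
      rwa [pCoeff_at_lam] at this
    · simp only [hd, mul_one]
      have := ((continuous_pCoeff_def lam).tendsto (-lam)).mono_left (nhdsWithin_le_nhds (s := Ioi (-lam)))
      rwa [pCoeff_at_neg_lam] at this

/-- The boundary expression (1.20) VANISHES IDENTICALLY on `φ_+` off `0`:
`x sin(2πλx) φ_+′(x) − (2πλx cos(2πλx) − sin(2πλx)) φ_+(x) = 0`.
[cite: ConnesMoscovici2022, §1 (1.18)/(1.20) (= arXiv:2112.05500 chunk p0006:L23–L30, L64)] -/
theorem bcInfEven_phiPlus (hlam : 0 < lam) {x : ℝ} (hx : x ≠ 0) : bcInfEven lam (phiPlus lam) x = 0 := by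
  rw [bcInfEven, deriv_phiPlus_of_ne_zero hlam hx, phiPlus_of_ne_zero hlam hx]
  have hπ : (π : ℂ) ≠ 0 := by exact_mod_cast Real.pi_ne_zero
  have hx' : (x : ℂ) ≠ 0 := by exact_mod_cast hx
  push_cast
  field_simp
  ring

/-- The boundary expression (1.21) on `φ_-` off `0`:
`= (i/2π²)(−2πλ/x + sin(2πλx)cos(2πλx)/x²)`. [cite: ConnesMoscovici2022, §1 (1.21) (= arXiv:2112.05500 chunk p0006:L67–L69)] -/
theorem bcInfOdd_phiMinus (hlam : 0 < lam) {x : ℝ} (hx : x ≠ 0) :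
    bcInfOdd lam (phiMinus lam) x =
      I * (((-(2 * π * lam) * x + Real.sin (2 * π * lam * x) * Real.cos (2 * π * lam * x)) /
        (2 * π ^ 2 * x ^ 2) : ℝ) : ℂ) := by
  set ω : ℝ := 2 * π * lam with hω
  set N : ℝ → ℝ := fun t ↦ ω * t * Real.cos (ω * t) - Real.sin (ω * t) with hNdef
  set D : ℝ → ℝ := fun t ↦ 2 * π ^ 2 * t ^ 2 with hDdef
  -- the explicit formula for `φ_-` near `x` and its derivative there
  have hev : phiMinus lam =ᶠ[𝓝 x] fun t : ℝ ↦ I * (((N / D) t : ℝ) : ℂ) := by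
    filter_upwards [isOpen_ne.mem_nhds hx] with t ht
    rw [phiMinus_of_ne_zero hlam ht]
    simp only [hNdef, hDdef, Pi.div_apply, hω]
  have hN : HasDerivAt N
      ((ω * 1 * Real.cos (ω * x) + ω * x * (-Real.sin (ω * x) * (ω * 1))) -
        Real.cos (ω * x) * (ω * 1)) x := by
    have h1 : HasDerivAt (fun t : ℝ ↦ ω * t) (ω * 1) x := (hasDerivAt_id x).const_mul ω
    exact ((h1.mul h1.cos).sub h1.sin)
  have hD : HasDerivAt D (2 * π ^ 2 * (2 * x)) x := by
    simpa using (hasDerivAt_pow 2 x).const_mul (2 * π ^ 2)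
  have hDx : D x ≠ 0 := by simp only [hDdef]; positivity
  have hQ := (hN.div hD hDx).ofReal_comp.const_mul I
  have hπ : (π : ℂ) ≠ 0 := by exact_mod_cast Real.pi_ne_zero
  have hx' : (x : ℂ) ≠ 0 := by exact_mod_cast hx
  have key : bcInfOdd lam (phiMinus lam) x =
      I * (((-ω * x * (Real.sin (ω * x) ^ 2 + Real.cos (ω * x) ^ 2) +
        Real.sin (ω * x) * Real.cos (ω * x)) / (2 * π ^ 2 * x ^ 2) : ℝ) : ℂ) := by
    rw [bcInfOdd, hev.deriv_eq, hQ.deriv, phiMinus_of_ne_zero hlam hx]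
    simp only [← hω, hNdef, hDdef]
    push_cast
    field_simp
    ring
  rw [key, Real.sin_sq_add_cos_sq, mul_one]

/-- The right-hand side of `bcInfOdd_phiMinus` tends to `0` at `+∞`. [cite: ConnesMoscovici2022, §1 (1.21) (= arXiv:2112.05500 chunk p0006:L67–L69)] -/
theorem tendsto_bcInfOdd_phiMinus_atTop (hlam : 0 < lam) :
    Tendsto (bcInfOdd lam (phiMinus lam)) atTop (𝓝 0) := by
  have hev : bcInfOdd lam (phiMinus lam) =ᶠ[atTop] fun x : ℝ ↦
      I * (((-(2 * π * lam) * x + Real.sin (2 * π * lam * x) * Real.cos (2 * π * lam * x)) /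
        (2 * π ^ 2 * x ^ 2) : ℝ) : ℂ) := by
    filter_upwards [eventually_gt_atTop 0] with x hx
    exact bcInfOdd_phiMinus hlam hx.ne'
  refine Tendsto.congr' hev.symm ?_
  -- the real quantity tends to zero
  have hreal : Tendsto (fun x : ℝ ↦ (-(2 * π * lam) * x +
      Real.sin (2 * π * lam * x) * Real.cos (2 * π * lam * x)) / (2 * π ^ 2 * x ^ 2)) atTop (𝓝 0) := by
    have hb : Tendsto (fun x : ℝ ↦ (2 * π * lam) / (2 * π ^ 2) * x⁻¹ + (2 * π ^ 2)⁻¹ * (x ^ 2)⁻¹)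
        atTop (𝓝 ((2 * π * lam) / (2 * π ^ 2) * 0 + (2 * π ^ 2)⁻¹ * 0)) :=
      (tendsto_inv_atTop_zero.const_mul _).add
        ((tendsto_inv_atTop_zero.comp (tendsto_pow_atTop two_ne_zero)).const_mul _)
    rw [mul_zero, mul_zero, add_zero] at hb
    refine squeeze_zero_norm' ?_ hb
    filter_upwards [eventually_gt_atTop 0] with x hx
    have hx2 : 0 < 2 * π ^ 2 * x ^ 2 := by positivity
    rw [Real.norm_eq_abs, abs_div, abs_of_pos hx2]
    have hsc : |Real.sin (2 * π * lam * x) * Real.cos (2 * π * lam * x)| ≤ 1 := by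
      rw [abs_mul]
      exact mul_le_one₀ (Real.abs_sin_le_one _) (abs_nonneg _) (Real.abs_cos_le_one _)
    have hnum : |-(2 * π * lam) * x + Real.sin (2 * π * lam * x) * Real.cos (2 * π * lam * x)| ≤
        2 * π * lam * x + 1 := by
      refine (abs_add_le _ _).trans ?_
      rw [abs_mul, abs_neg, abs_of_pos (by positivity : (0:ℝ) < 2 * π * lam), abs_of_pos hx]
      linarith
    calc |-(2 * π * lam) * x + Real.sin (2 * π * lam * x) * Real.cos (2 * π * lam * x)| /
          (2 * π ^ 2 * x ^ 2)
        ≤ (2 * π * lam * x + 1) / (2 * π ^ 2 * x ^ 2) := by gcongr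
      _ = (2 * π * lam) / (2 * π ^ 2) * x⁻¹ + (2 * π ^ 2)⁻¹ * (x ^ 2)⁻¹ := by
          field_simp
  have h := (continuous_ofReal.tendsto 0).comp hreal
  rw [ofReal_zero] at h
  simpa using h.const_mul I

/-- **`𝓕β_+ ∈ 𝓛_β`** (representative `φ_+`, smooth on `ℝ`; (1.19) by continuity at `±λ`, (1.20)
vanishes identically, (1.21) trivially since `φ_+` is even).
[cite: ConnesMoscovici2022, Thm 1.6 proof (= arXiv:2112.05500 chunk p0006:L83–L85)] -/
theorem fourier_betaPlus_mem_prolateSASet (hlam : 0 < lam) :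
    (𝓕 (betaPlus lam hlam) : L2R) ∈ prolateSASet lam := by
  have hmem : (𝓕 (betaPlus lam hlam) : L2R) ∈ (prolateMax lam).domain :=
    fourierL2_mem_prolateMax lam (betaPlus_mem_prolateMax hlam).1
  refine ⟨hmem, phiPlus lam, fourier_betaPlus_coeFn hlam, ?_⟩
  have h1 : ContDiff ℝ 1 (phiPlus lam) := contDiff_phiPlus_nat lam 1
  have hd : Differentiable ℝ (phiPlus lam) := h1.differentiable one_ne_zero
  have hc : Continuous fun x ↦ pCoeff lam x * deriv (phiPlus lam) x :=
    (continuous_pCoeff_def lam).mul (h1.continuous_deriv le_rfl)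
  have hev : evenFn (phiPlus lam) = phiPlus lam := evenFn_eq_self_of_even (phiPlus_neg lam)
  have hod : oddFn (phiPlus lam) = fun _ ↦ 0 := oddFn_eq_zero_of_even (phiPlus_neg lam)
  refine ⟨hd.differentiableOn, ?_, ?_, ?_, ?_, ?_, ?_⟩
  · have := (hc.tendsto lam).mono_left (nhdsWithin_le_nhds (s := {x | x ≠ lam ∧ x ≠ -lam}))
    rwa [pCoeff_at_lam, zero_mul] at this
  · have := (hc.tendsto (-lam)).mono_left (nhdsWithin_le_nhds (s := {x | x ≠ lam ∧ x ≠ -lam}))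
    rwa [pCoeff_at_neg_lam, zero_mul] at this
  · rw [hev]
    refine tendsto_const_nhds.congr' ?_
    filter_upwards [eventually_gt_atTop 0] with x hx
    exact (bcInfEven_phiPlus hlam hx.ne').symm
  · rw [hev]
    refine tendsto_const_nhds.congr' ?_
    filter_upwards [eventually_lt_atBot 0] with x hx
    exact (bcInfEven_phiPlus hlam hx.ne).symm
  · rw [hod, bcInfOdd_zero]; exact tendsto_const_nhds
  · rw [hod, bcInfOdd_zero]; exact tendsto_const_nhds

/-- **`𝓕β_- ∈ 𝓛_β`** (representative `φ_-`; (1.19) by continuity, (1.20) trivially since `φ_-` is odd,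
(1.21) from `bcInfOdd_phiMinus`). [cite: ConnesMoscovici2022, Thm 1.6 proof (= arXiv:2112.05500 chunk p0006:L83–L85)] -/
theorem fourier_betaMinus_mem_prolateSASet (hlam : 0 < lam) :
    (𝓕 (betaMinus lam hlam) : L2R) ∈ prolateSASet lam := by
  have hmem : (𝓕 (betaMinus lam hlam) : L2R) ∈ (prolateMax lam).domain :=
    fourierL2_mem_prolateMax lam (betaMinus_mem_prolateMax hlam).1
  refine ⟨hmem, phiMinus lam, fourier_betaMinus_coeFn hlam, ?_⟩
  have h1 : ContDiff ℝ 1 (phiMinus lam) := (contDiff_phiMinus lam).of_le (by norm_num)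
  have hd : Differentiable ℝ (phiMinus lam) := h1.differentiable one_ne_zero
  have hc : Continuous fun x ↦ pCoeff lam x * deriv (phiMinus lam) x :=
    (continuous_pCoeff_def lam).mul (h1.continuous_deriv le_rfl)
  have hev : evenFn (phiMinus lam) = fun _ ↦ 0 := evenFn_eq_zero_of_odd (phiMinus_neg lam)
  have hod : oddFn (phiMinus lam) = phiMinus lam := oddFn_eq_self_of_odd (phiMinus_neg lam)
  refine ⟨hd.differentiableOn, ?_, ?_, ?_, ?_, ?_, ?_⟩
  · have := (hc.tendsto lam).mono_left (nhdsWithin_le_nhds (s := {x | x ≠ lam ∧ x ≠ -lam}))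
    rwa [pCoeff_at_lam, zero_mul] at this
  · have := (hc.tendsto (-lam)).mono_left (nhdsWithin_le_nhds (s := {x | x ≠ lam ∧ x ≠ -lam}))
    rwa [pCoeff_at_neg_lam, zero_mul] at this
  · rw [hev, bcInfEven_zero]; exact tendsto_const_nhds
  · rw [hev, bcInfEven_zero]; exact tendsto_const_nhds
  · rw [hod]; exact tendsto_bcInfOdd_phiMinus_atTop hlam
  · rw [hod]
    exact tendsto_atBot_zero_of_odd (bcInfOdd_neg_of_odd lam (phiMinus_neg lam))
      (tendsto_bcInfOdd_phiMinus_atTop hlam)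

/-- **`𝓕⁻¹β_+ ∈ 𝓛_β`, `𝓕⁻¹β_- ∈ 𝓛_β`** (by parity). [cite: ConnesMoscovici2022, Thm 1.6 proof (= arXiv:2112.05500 chunk p0006:L83–L85)] -/
theorem fourierInv_betaPlus_mem_prolateSASet (hlam : 0 < lam) :
    (𝓕⁻ (betaPlus lam hlam) : L2R) ∈ prolateSASet lam := by
  rw [fourierInv_betaPlus]; exact fourier_betaPlus_mem_prolateSASet hlam

/-- `𝓕⁻¹β_- ∈ 𝓛_β`. [cite: ConnesMoscovici2022, Thm 1.6 proof (= arXiv:2112.05500 chunk p0006:L83–L85)] -/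
theorem fourierInv_betaMinus_mem_prolateSASet (hlam : 0 < lam) :
    (𝓕⁻ (betaMinus lam hlam) : L2R) ∈ prolateSASet lam := by
  rw [fourierInv_betaMinus]
  exact (prolateSADomain lam hlam).neg_mem (fourier_betaMinus_mem_prolateSASet hlam)

end Literature.NumberTheory.ConnesMoscovici2022

end
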